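import Literature.Computability.AlgebraicComplexity.MS2001TracePowerRemark
import Literature.Computability.AlgebraicComplexity.OrbitClosureWeightDegenerations
import Literature.Computability.AlgebraicComplexity.MS2001GenericCircuitForm
import Literature.Computability.AlgebraicComplexity.BenOrCleveIMMThree
import Literature.Computability.AlgebraicComplexity.MS2001Prop44Approximation
import HarnessLib

/-!
# GCT I §4.1, closing Remark, characteristic `0`: the Prop. 4.1 analogue HOLDS for `trace(Y^N)`
# — every form with a small formula is a padded point of `Δ[trace(Y^N)]`, `N` polynomial

Topic `Computability/AlgebraicComplexity`. Cell `val-lit`, row MS2001-A (K. Mulmuley, M. Sohoni,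
*Geometric complexity theory I*, SIAM J. Comput. 31 (2001) 496–526), §4.1 closing Remark, typed
from the AUTHORS' VERSION (AV p.16, all.txt L1122–1124; text of record
`run/shared/lean/pub/val-lit/bip/texts/MS2001-authorversion/`):

> "Remark: The role of the determinant in this section can also be played by the trace:
> specifically, the analogues of Proposition 4.1 and Theorem 4.6 hold for `trace(Y^m)` as well."

The companion file `MS2001TracePowerRemark.lean` types the form `tracePow F n m = trace(Y^m)` and
proves that BOTH announced analogues FAIL when `char F ∣ m` (and hold for `m = 2` away from
characteristic `2`), leaving characteristic `0` and general `m` open ("Beyond `m = 2`,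
characteristic `0` is NOT addressed here"). This file proves the **Prop. 4.1 analogue in
characteristic `0`** (the print gives no proof; the construction below is ours):

* `MS2001_rem_4_1_trace_prop_4_1_analogue_charZero` — over a field `F` of characteristic `0`, if a
  form `f` of degree `d` has a formula (expression) of size `≤ s`, then for every
  `n ≥ 6(s+1)^16 + 1` and `N = 6n + 1 ≥ d`, for EVERY placement `ι` of the variables of `f` among
  the entries of the `N × N` matrix `Y` and every entry `y`, the padded form `y^{N-d} · f` lies in
  the orbit closure `Δ[trace(Y^N)]` of `tracePow F N N` (compare the tree's `MS2001_prop_4_1`: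
  every `m ≥ 2·size + 2` for `det_m`; here `N ≥ 36(s+1)^16 + 7` through the tree's Brent constant,
  TODO(sharper form): `N = O(s²)` with Brent's optimal depth reduction; only `N ≡ 1 (mod 6)`).
* `X_pow_mul_rename_mem_orbitClosure_tracePow_of_isProjection` — the same for every form that is a
  Valiant projection of the iterated matrix multiplication polynomial `IMM_{3,n} = immPoly 3 n F`
  (`= tr(X_1 ⋯ X_n)`, `3 × 3` matrices), `n ≥ 1`, over any field in which `n · C(6n+1, n) ≠ 0`.
* `X_pow_mul_rename_immPoly_mem_orbitClosure_tracePow` — the heart: `y^{N-n} · IMM_{3,n}(X_ι)`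
  lies in `Δ[trace(Y^N)]`, `N = 6n + 1`, for every placement `ι` and entry `y`.

## Proof (ours; the printed Remark has no proof)

Brent and Ben-Or–Cleve (tree: `exists_formula_four_pow_depth_le`,
`BenOrCleve.isProjection_immPoly_three`) make every `f` of expression size `≤ s` a projection of
`IMM_{3,n}` for every `n ≥ 6(s+1)^16 + 1`, so by the padding
lemma of the tree (`X_pow_mul_rename_mem_endOrbit_of_isProjection`, "eq. (3)" of the printed proof
of Prop. 4.1) and the transitivity of orbit closures it suffices to put the padded `IMM_{3,n}` into
`Δ[trace(Y^N)]`. THE GADGET (§2–§4): index the rows/columns of `Y` by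
`V = (Fin n × Fin 3) ⊕ Option (Fin n × Fin 3)` (`|V| = 6n + 1 = N`, odd) and substitute for `Y`
the block-diagonal matrix of linear forms

  `G = diag(ℓ · 1_{3n} + C, D)`, `C` = the block-cyclic matrix with the `3 × 3` variable blocks
  `X_0, …, X_{n-1}` of `IMM_{3,n}` above the diagonal (cyclically), `D = diag(-ℓ, …, -ℓ, 0)`
  (`3n` entries `-ℓ`, one `0`), `ℓ` one more variable.

Since `ℓ · 1` commutes with `C`, the binomial theorem gives
`trace(G^N) = ∑_k C(N,k) ℓ^{N-k} trace(C^k) + 3n (-ℓ)^N`; the `k = 0` term `3n ℓ^N` cancels against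
`trace(D^N) = -3n ℓ^N` (`N` odd); `trace(C^k) = 0` unless `n ∣ k` (block-cyclicity,
`cycBlock_pow_apply`), and `trace(C^n) = n · IMM_{3,n}` (all `n` cyclic products have the same
trace). Hence, grading by the number of `X`-variables (weight `1` on them, `0` on `ℓ`), the
substituted form `trace(G^N) ∈ End · trace(Y^N) ⊆ Δ[trace(Y^N)]` has no component of weight `< n`
and its weight-`n` component is `n C(N,n) · ℓ^{N-n} · IMM_{3,n}`; by the weight-degeneration device
of GCT I §4.2 (tree: `weightedHomogeneousComponent_mem_orbitClosure`) and the cone property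
(`smul_mem_orbitClosure`) the padded `IMM_{3,n}` lies in `Δ[trace(Y^N)]`.

Everything is a theorem; the gadget's data (`cycBlock`, `cycProd`, `gadgetCoef`, …) are
definitions with bodies in the namespace `MS2001TracePowFormulas` (no named facts, no instances, no
`sorry`). Honest framing: literature bookkeeping on an unnumbered remark (a universality statement
for the trace of a matrix power under degenerations); nothing here bears on any separation
(`VP ≠ VNP` is NOT proved).

## v2 (same seat)

* `X_pow_mul_rename_detPoly_mem_orbitClosure_tracePow_complex` — over `ℂ` the padded determinant
  `y^{N-m} det_m(X_ι)` itself lies in `Δ[trace(Y^N)]` for `N` quasi-polynomial in `m` (the headline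
  applied to `det_m` with its quasi-polynomial formula size, tree
  `formulaComplexity_le_of_hasDetRepr`).

## References

* [MulmuleySohoniSIAM2001] K. Mulmuley, M. Sohoni, *Geometric complexity theory I*, SIAM J.
  Comput. 31 (2001) 496–526, §4.1 closing Remark (AV p.16, all.txt L1122–1124); Prop. 4.1
  (AV p.12, L756).
* [BenOrCleve1992] M. Ben-Or, R. Cleve, *Computing algebraic formulas using a constant number of
  registers*, SIAM J. Comput. 21 (1992), Thm. 1 (tree: `BenOrCleveIMMThree.lean`).
-/

noncomputable section

open MvPolynomial

namespace Literature.Computability.AlgebraicComplexity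

universe u v

/-! ## §1. Generic matrix bookkeeping -/

namespace MS2001TracePowFormulas

section Generic

variable {R : Type u} [CommRing R]

/-- `trace (fromBlocks A B C D) = trace A + trace D`. [folklore] -/
private theorem trace_fromBlocks {l m : Type*} [Fintype l] [Fintype m] (A : Matrix l l R)
    (B : Matrix l m R) (C : Matrix m l R) (D : Matrix m m R) :
    (Matrix.fromBlocks A B C D).trace = A.trace + D.trace := by
  simp [Matrix.trace, Fintype.sum_sum_type]

/-- The trace is invariant under re-indexing by a bijection. [folklore] -/
private theorem trace_reindex {l m : Type*} [Fintype l] [Fintype m] (e : l ≃ m) (M : Matrix l l R) :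
    (Matrix.reindex e e M).trace = M.trace := by
  simp only [Matrix.trace, Matrix.diag, Matrix.reindex_apply, Matrix.submatrix_apply]
  exact e.symm.sum_comp (fun i => M i i)

/-- Powers commute with re-indexing by a bijection. [folklore] -/
private theorem reindex_pow {l m : Type*} [Fintype l] [Fintype m] [DecidableEq l] [DecidableEq m]
    (e : l ≃ m) (M : Matrix l l R) (k : ℕ) :
    (Matrix.reindex e e M) ^ k = Matrix.reindex e e (M ^ k) := by
  have h := map_pow (Matrix.reindexAlgEquiv R R e) M k
  rw [Matrix.coe_reindexAlgEquiv] at h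
  exact h.symm

/-- An algebra map commutes with the trace of a power: `φ (trace (M^k)) = trace ((M.map φ)^k)`.
[folklore] -/
private theorem algHom_trace_pow {S : Type v} [CommRing S] {F : Type*} [CommSemiring F] [Algebra F R]
    [Algebra F S] {m : Type*} [Fintype m] [DecidableEq m] (φ : R →ₐ[F] S) (M : Matrix m m R)
    (k : ℕ) : φ ((M ^ k).trace) = ((M.map φ) ^ k).trace := by
  have h : (M ^ k).map φ = (M.map φ) ^ k := by
    rw [← AlgHom.mapMatrix_apply, map_pow, AlgHom.mapMatrix_apply]
  rw [← h]
  simp [Matrix.trace, Matrix.diag, map_sum]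

/-- If every entry of `M` is weighted-homogeneous of weight `1`, every entry of `M^k` is
weighted-homogeneous of weight `k`. [folklore] -/
private theorem isWeightedHomogeneous_pow_apply {σ : Type*} {F : Type*} [CommSemiring F] {m : Type*}
    [Fintype m] [DecidableEq m] (w : σ → ℕ) {M : Matrix m m (MvPolynomial σ F)}
    (hM : ∀ i j, IsWeightedHomogeneous w (M i j) 1) :
    ∀ (k : ℕ) (i j : m), IsWeightedHomogeneous w ((M ^ k) i j) k
  | 0, i, j => by
    rw [pow_zero, Matrix.one_apply]
    split_ifs
    · exact isWeightedHomogeneous_one F w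
    · exact isWeightedHomogeneous_zero F w 0
  | k + 1, i, j => by
    rw [pow_succ, Matrix.mul_apply]
    exact IsWeightedHomogeneous.sum _ _ _ fun l _ =>
      (isWeightedHomogeneous_pow_apply w hM k i l).mul (hM l j)

end Generic

/-! ## §2. The block-cyclic matrix of `3 × 3` blocks and its powers -/

section Cyclic

variable {R : Type u} [CommRing R] {n : ℕ} [NeZero n]

/-- The block-cyclic matrix with `3 × 3` blocks `B_0, …, B_{n-1}` in positions `(i, i+1)`
(cyclically): `C_{(i,p),(j,q)} = [j = i+1] (B_i)_{pq}` — the "weighted `n`-cycle with matrix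
weights". Its powers walk around the cycle (`cycBlock_pow_apply`). [folklore] -/
def cycBlock (B : Fin n → Matrix (Fin 3) (Fin 3) R) : Matrix (Fin n × Fin 3) (Fin n × Fin 3) R :=
  Matrix.of fun a b => if b.1 = a.1 + 1 then B a.1 a.2 b.2 else 0

/-- The ordered cyclic product `B_i B_{i+1} ⋯ B_{i+l-1}` (indices mod `n`). [folklore] -/
def cycProd (B : Fin n → Matrix (Fin 3) (Fin 3) R) (i : Fin n) (l : ℕ) :
    Matrix (Fin 3) (Fin 3) R :=
  (List.ofFn fun t : Fin l => B (i + (t : ℕ) • (1 : Fin n))).prod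

/-- `cycProd B i 0 = 1`. [folklore] -/
private theorem cycProd_zero (B : Fin n → Matrix (Fin 3) (Fin 3) R) (i : Fin n) : cycProd B i 0 = 1 := by
  simp [cycProd]

/-- Right recursion: `B_i ⋯ B_{i+l} = (B_i ⋯ B_{i+l-1}) · B_{i+l}`. [folklore] -/
private theorem cycProd_succ (B : Fin n → Matrix (Fin 3) (Fin 3) R) (i : Fin n) (l : ℕ) :
    cycProd B i (l + 1) = cycProd B i l * B (i + l • (1 : Fin n)) := by
  rw [cycProd, List.ofFn_succ', List.concat_eq_append, List.prod_append, List.prod_singleton]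
  simp only [Fin.val_castSucc, Fin.val_last]
  rfl

/-- Left recursion: `B_i ⋯ B_{i+l} = B_i · (B_{i+1} ⋯ B_{i+l})`. [folklore] -/
private theorem cycProd_succ' (B : Fin n → Matrix (Fin 3) (Fin 3) R) (i : Fin n) (l : ℕ) :
    cycProd B i (l + 1) = B i * cycProd B (i + 1) l := by
  have hfun : (fun t : Fin l => B (i + ((t : ℕ) + 1) • (1 : Fin n))) =
      fun t : Fin l => B (i + 1 + (t : ℕ) • (1 : Fin n)) := by
    funext t
    rw [succ_nsmul, ← add_assoc, add_right_comm]
  simp only [cycProd, List.ofFn_succ, List.prod_cons, Fin.val_zero, zero_nsmul, add_zero,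
    Fin.val_succ, hfun]

/-- **Powers of the block-cyclic matrix**: `(C^l)_{(i,p),(j,q)} = [j = i + l] (B_i ⋯ B_{i+l-1})_{pq}`.
[folklore] -/
private theorem cycBlock_pow_apply (B : Fin n → Matrix (Fin 3) (Fin 3) R) (l : ℕ) (a b : Fin n × Fin 3) :
    (cycBlock B ^ l) a b = if b.1 = a.1 + l • (1 : Fin n) then cycProd B a.1 l a.2 b.2 else 0 := by
  induction l generalizing a b with
  | zero =>
    rw [pow_zero, Matrix.one_apply, cycProd_zero, zero_nsmul, add_zero, Matrix.one_apply]
    obtain ⟨i, p⟩ := a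
    obtain ⟨j, q⟩ := b
    by_cases hij : j = i
    · subst hij
      by_cases hpq : p = q
      · subst hpq; simp
      · simp [hpq]
    · have : ¬ ((i, p) : Fin n × Fin 3) = (j, q) := fun h => hij (Prod.mk.inj h).1.symm
      simp [this, hij]
  | succ l ih =>
    obtain ⟨i, p⟩ := a
    obtain ⟨j, q⟩ := b
    rw [pow_succ, Matrix.mul_apply, Fintype.sum_prod_type]
    rw [Finset.sum_eq_single (i + l • (1 : Fin n))]
    · -- the surviving layer
      have hC : ∀ r : Fin 3, cycBlock B (i + l • (1 : Fin n), r) (j, q) =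
          if j = i + (l + 1) • (1 : Fin n) then B (i + l • (1 : Fin n)) r q else 0 := by
        intro r
        simp only [cycBlock, Matrix.of_apply, succ_nsmul, ← add_assoc]
      simp only [ih, hC, if_true]
      by_cases hj : j = i + (l + 1) • (1 : Fin n)
      · simp only [if_pos hj, cycProd_succ, Matrix.mul_apply]
      · simp only [if_neg hj, mul_zero, Finset.sum_const_zero]
    · intro u _ hu
      simp only [ih, if_neg hu, zero_mul, Finset.sum_const_zero]
    · intro h
      exact absurd (Finset.mem_univ _) h

open Fin.NatCast in
/-- `l • 1 = 0` in `Fin n` iff `n ∣ l`. [folklore] -/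
private theorem nsmul_one_eq_zero_iff (l : ℕ) : l • (1 : Fin n) = 0 ↔ n ∣ l := by
  rw [nsmul_one, Fin.natCast_eq_zero]

/-- **`trace(C^l) = 0` unless `n ∣ l`** (a closed walk goes around the cycle a whole number of
times). [folklore] -/
private theorem trace_cycBlock_pow_of_not_dvd (B : Fin n → Matrix (Fin 3) (Fin 3) R) {l : ℕ}
    (hl : ¬ n ∣ l) : (cycBlock B ^ l).trace = 0 := by
  simp only [Matrix.trace, Matrix.diag, cycBlock_pow_apply]
  refine Finset.sum_eq_zero fun a _ => ?_
  rw [if_neg]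
  intro h
  apply hl
  rw [← nsmul_one_eq_zero_iff (n := n) l]
  simpa using h.symm

/-- All cyclic products of full length `n` have the same trace: `tr(B_{i+1} ⋯ B_{i+n}) =
tr(B_i ⋯ B_{i+n-1})`. [folklore] -/
private theorem trace_cycProd_succ (B : Fin n → Matrix (Fin 3) (Fin 3) R) (i : Fin n) :
    (cycProd B (i + 1) n).trace = (cycProd B i n).trace := by
  obtain ⟨m, rfl⟩ : ∃ m, n = m + 1 := Nat.exists_eq_add_one_of_ne_zero (NeZero.ne n)
  have h1 : cycProd B i (m + 1) = B i * cycProd B (i + 1) m := cycProd_succ' B i m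
  have h2 : cycProd B (i + 1) (m + 1) = cycProd B (i + 1) m * B i := by
    rw [cycProd_succ]
    congr 2
    rw [add_assoc, ← succ_nsmul',
      (nsmul_one_eq_zero_iff (n := m + 1) (m + 1)).mpr (dvd_refl (m + 1)), add_zero]
  rw [h1, h2, Matrix.trace_mul_comm]

open Fin.NatCast in
/-- Hence `tr(B_i ⋯ B_{i+n-1}) = tr(B_0 ⋯ B_{n-1})` for every `i`. [folklore] -/
private theorem trace_cycProd_eq (B : Fin n → Matrix (Fin 3) (Fin 3) R) (i : Fin n) :
    (cycProd B i n).trace = (cycProd B 0 n).trace := by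
  have key : ∀ j : ℕ, (cycProd B (j • (1 : Fin n)) n).trace = (cycProd B 0 n).trace := by
    intro j
    induction j with
    | zero => rw [zero_nsmul]
    | succ j ih => rw [succ_nsmul, trace_cycProd_succ, ih]
  have hi : i = (i : ℕ) • (1 : Fin n) := by
    rw [nsmul_one, Fin.cast_val_eq_self]
  rw [hi]
  exact key i

/-- **`trace(C^n) = n · tr(B_0 ⋯ B_{n-1})`**. [folklore] -/
private theorem trace_cycBlock_pow_self (B : Fin n → Matrix (Fin 3) (Fin 3) R) :
    (cycBlock B ^ n).trace = n • (cycProd B 0 n).trace := by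
  simp only [Matrix.trace, Matrix.diag, cycBlock_pow_apply,
    (nsmul_one_eq_zero_iff (n := n) n).mpr (dvd_refl n), add_zero, if_true]
  rw [Fintype.sum_prod_type]
  simp only
  have : ∀ i : Fin n, ∑ p : Fin 3, cycProd B i n p p = (cycProd B 0 n).trace := by
    intro i
    rw [← trace_cycProd_eq B i]
    rfl
  simp only [this, Finset.sum_const, Finset.card_univ, Fintype.card_fin]

end Cyclic

/-! ## §3. The gadget: `G = diag(ℓ·1 + C, diag(-ℓ,…,-ℓ,0))` as a linear substitution of `Y` -/

section Gadget

/-- The vertex type of the gadget: `3n` vertices carrying the block cycle, `3n` vertices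
carrying the cancelling loops `-ℓ`, one isolated vertex (to make `|V| = 6n+1` odd). [folklore] -/
abbrev Vtx (n : ℕ) : Type := (Fin n × Fin 3) ⊕ Option (Fin n × Fin 3)

/-- `|V| = 6n + 1`. [folklore] -/
private theorem card_vtx (n : ℕ) : Fintype.card (Vtx n) = 6 * n + 1 := by
  simp only [Vtx, Fintype.card_sum, Fintype.card_prod, Fintype.card_fin, Fintype.card_option]
  ring

variable {F : Type u} [Field F] {n : ℕ} [NeZero n]
variable {N : ℕ} (e : Vtx n ≃ Fin N)

/-- The padding variable's position `ω = (v₀, v₀)`, `v₀` the isolated vertex. [folklore] -/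
def padPos : Fin N × Fin N := (e (Sum.inr none), e (Sum.inr none))

/-- The placement of the `IMM_{3,n}` variable `X^{(t)}_{pq}` at the entry `((t,p), (t+1,q))` of
`Y` (the edge `(t,p) → (t+1,q)` of the block cycle). [folklore] -/
def kappa : Fin n × Fin 3 × Fin 3 → Fin N × Fin N :=
  fun tpq => (e (Sum.inl (tpq.1, tpq.2.1)), e (Sum.inl (tpq.1 + 1, tpq.2.2)))

/-- `κ` is injective. [folklore] -/
private theorem kappa_injective : Function.Injective (kappa e) := by
  rintro ⟨t, p, q⟩ ⟨t', p', q'⟩ h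
  simp only [kappa, Prod.mk.injEq, e.apply_eq_iff_eq, Sum.inl.injEq] at h
  obtain ⟨⟨rfl, rfl⟩, -, rfl⟩ := h
  rfl

/-- `ω` is not a `κ`-position. [folklore] -/
private theorem kappa_ne_padPos (tpq : Fin n × Fin 3 × Fin 3) : kappa e tpq ≠ padPos e := by
  intro h
  have := congrArg Prod.fst h
  simp [kappa, padPos] at this

/-- The variable blocks `X_t = (y_{κ(t,p,q)})_{pq}` of the gadget (the renamed `IMM` matrices).
[folklore] -/
def xBlock (t : Fin n) : Matrix (Fin 3) (Fin 3) (MvPolynomial (Fin N × Fin N) F) :=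
  Matrix.of fun p q => X (kappa e (t, p, q))

/-- The loop block `diag(-ℓ, …, -ℓ, 0)` (`-ℓ` on the `3n` vertices `some _`, `0` on `none`).
[folklore] -/
def loopBlock : Matrix (Option (Fin n × Fin 3)) (Option (Fin n × Fin 3))
    (MvPolynomial (Fin N × Fin N) F) :=
  Matrix.diagonal fun o => o.elim 0 fun _ => -(X (padPos e) : MvPolynomial (Fin N × Fin N) F)

/-- The gadget matrix `G = diag(ℓ · 1 + C, diag(-ℓ,…,-ℓ,0))` over `V`. [folklore] -/
def gadget : Matrix (Vtx n) (Vtx n) (MvPolynomial (Fin N × Fin N) F) :=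
  Matrix.fromBlocks (cycBlock (xBlock (F := F) e) + (X (padPos e) : MvPolynomial _ F) • 1) 0 0
    (loopBlock (F := F) e)

/-- The coefficient vectors of the gadget's entries (each entry is `0`, `± ℓ`, a variable, or a
variable `+ ℓ`): `gadgetCoef u v p` = coefficient of `y_p` in `G_{uv}`. [folklore] -/
def gadgetCoef : Vtx n → Vtx n → (Fin N × Fin N) → F
  | Sum.inl a, Sum.inl b => fun p =>
      (if b.1 = a.1 + 1 ∧ p = (e (Sum.inl a), e (Sum.inl b)) then 1 else 0) +
        (if a = b ∧ p = padPos e then 1 else 0)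
  | Sum.inr (some x), Sum.inr (some y) => fun p => if x = y ∧ p = padPos e then -1 else 0
  | Sum.inl _, Sum.inr _ => fun _ => 0
  | Sum.inr _, Sum.inl _ => fun _ => 0
  | Sum.inr none, Sum.inr _ => fun _ => 0
  | Sum.inr (some _), Sum.inr none => fun _ => 0

/-- The substitution matrix of the gadget: column `v = (i,j)` (an entry of `Y`) holds the
coefficient vector of `G_{e⁻¹ i, e⁻¹ j}`. [folklore] -/
def gadgetSubst : Matrix (Fin N × Fin N) (Fin N × Fin N) F :=
  fun p v => gadgetCoef (F := F) e (e.symm v.1) (e.symm v.2) p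

/-- The linear forms substituted for the entries of `Y` are the gadget's entries. [folklore] -/
private theorem sum_gadgetCoef_smul_X (u v : Vtx n) :
    (∑ p, gadgetCoef (F := F) e u v p • (X p : MvPolynomial (Fin N × Fin N) F)) =
      gadget (F := F) e u v := by
  classical
  rcases u with a | (_ | x) <;> rcases v with b | (_ | y)
  · -- cycle block + loops `ℓ`
    simp only [gadgetCoef, add_smul, Finset.sum_add_distrib, ite_smul, one_smul, zero_smul,
      gadget, Matrix.fromBlocks_apply₁₁, Matrix.add_apply, cycBlock, Matrix.of_apply, xBlock,
      kappa, Matrix.smul_apply, Matrix.one_apply, smul_eq_mul, mul_ite, mul_one, mul_zero]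
    congr 1
    · by_cases h : b.1 = a.1 + 1
      · simp only [h, true_and, Finset.sum_ite_eq', Finset.mem_univ, if_true]
        have hb : b = (a.1 + 1, b.2) := Prod.ext h rfl
        rw [hb]
      · simp [h]
    · by_cases h : a = b
      · simp [h]
      · simp [h]
  · simp [gadgetCoef, gadget]
  · simp [gadgetCoef, gadget]
  · simp [gadgetCoef, gadget]
  · simp [gadgetCoef, gadget, loopBlock]
  · simp [gadgetCoef, gadget, loopBlock]
  · simp [gadgetCoef, gadget]
  · simp [gadgetCoef, gadget, loopBlock]
  · simp only [gadgetCoef, gadget, loopBlock, Matrix.fromBlocks_apply₂₂, Matrix.diagonal_apply,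
      Option.some.injEq, Option.elim, ite_smul, neg_smul, one_smul, zero_smul]
    by_cases h : x = y
    · simp [h]
    · simp [h]

/-- The substitution sends `y_{ij}` to `G_{e⁻¹ i, e⁻¹ j}`. [folklore] -/
private theorem linSubst_gadgetSubst_X (v : Fin N × Fin N) :
    linSubst (Fin N × Fin N) F (gadgetSubst (F := F) e) (X v) =
      gadget (F := F) e (e.symm v.1) (e.symm v.2) := by
  rw [linSubst_X]
  exact sum_gadgetCoef_smul_X e _ _

/-- **The substituted form is the trace of a power of the gadget**:
`trace(Y^N)[Y ↦ G] = trace(G^N)`. [folklore] -/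
private theorem linSubst_gadgetSubst_tracePow (k : ℕ) :
    linSubst (Fin N × Fin N) F (gadgetSubst (F := F) e) (tracePow F N k) =
      ((gadget (F := F) e) ^ k).trace := by
  rw [tracePow, algHom_trace_pow]
  have hmap : (Matrix.mvPolynomialX (Fin N) (Fin N) F).map
      (linSubst (Fin N × Fin N) F (gadgetSubst (F := F) e)) =
      Matrix.reindex e e (gadget (F := F) e) := by
    ext i j
    rw [Matrix.map_apply, Matrix.mvPolynomialX_apply, linSubst_gadgetSubst_X,
      Matrix.reindex_apply, Matrix.submatrix_apply]
  rw [hmap, reindex_pow, trace_reindex]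

omit [NeZero n] in
/-- `trace(D^k) = 3n · (-ℓ)^k` for `k ≥ 1`. [folklore] -/
private theorem trace_loopBlock_pow {k : ℕ} (hk : 0 < k) :
    ((loopBlock (F := F) e) ^ k).trace =
      (3 * n) • (-(X (padPos e) : MvPolynomial (Fin N × Fin N) F)) ^ k := by
  rw [loopBlock, Matrix.diagonal_pow, Matrix.trace_diagonal, Fintype.sum_option]
  simp only [Pi.pow_apply, Option.elim, zero_pow hk.ne', zero_add, Finset.sum_const,
    Finset.card_univ, Fintype.card_prod, Fintype.card_fin]
  rw [mul_comm]

/-- **The trace of `G^N` expanded** (`N` odd): the binomial theorem for the commuting pair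
`(C, ℓ·1)`, with the `k = 0` term `3n ℓ^N` cancelled by `trace(D^N) = -3n ℓ^N`:
`trace(G^N) = ∑_{k=1}^{N} C(N,k) ℓ^{N-k} trace(C^k)`. [folklore] -/
private theorem trace_gadget_pow {M : ℕ} (hM : Odd M) :
    ((gadget (F := F) e) ^ M).trace =
      ∑ k ∈ Finset.range (M + 1),
        if k = 0 then 0 else
          M.choose k • ((X (padPos e) : MvPolynomial (Fin N × Fin N) F) ^ (M - k) *
            ((cycBlock (xBlock (F := F) e)) ^ k).trace) := by
  set ℓ : MvPolynomial (Fin N × Fin N) F := X (padPos e) with hℓ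
  set C := cycBlock (xBlock (F := F) e) with hC
  have hcomm : Commute C (ℓ • (1 : Matrix (Fin n × Fin 3) (Fin n × Fin 3) _)) :=
    (Commute.one_right C).smul_right ℓ
  have hbin : ((C + ℓ • 1) ^ M).trace =
      ∑ k ∈ Finset.range (M + 1), M.choose k • (ℓ ^ (M - k) * (C ^ k).trace) := by
    rw [hcomm.add_pow', Finset.Nat.sum_antidiagonal_eq_sum_range_succ_mk, Matrix.trace_sum]
    refine Finset.sum_congr rfl fun k _ => ?_
    rw [Matrix.trace_smul, smul_pow, one_pow, Matrix.mul_smul, Matrix.mul_one, Matrix.trace_smul,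
      smul_eq_mul]
  rw [gadget, Matrix.fromBlocks_diagonal_pow, trace_fromBlocks, ← hℓ, ← hC, hbin,
    trace_loopBlock_pow e hM.pos, Finset.sum_range_succ', Finset.sum_range_succ']
  simp only [Nat.succ_ne_zero, if_false, if_true, add_zero, Nat.choose_zero_right, Nat.sub_zero,
    pow_zero, Matrix.trace_one, Fintype.card_prod, Fintype.card_fin, one_smul]
  rw [hM.neg_pow, add_assoc, add_eq_left, smul_neg, nsmul_eq_mul, Nat.cast_comm, ← hℓ]
  push_cast
  ring

end Gadget

/-! ## §4. The weight grading: the lowest `X`-weight component of `trace(G^N)` is the padded `IMM` -/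

section Weights

variable {F : Type u} [Field F] {n : ℕ} [NeZero n] {N : ℕ} (e : Vtx n ≃ Fin N)

/-- The weight: `0` on the padding variable `ℓ = y_ω`, `1` on every other entry of `Y`. [folklore] -/
def wt : Fin N × Fin N → ℕ := fun p => if p = padPos e then 0 else 1

/-- Entries of the block cycle have weight `1`. [folklore] -/
private theorem isWeightedHomogeneous_cycBlock (a b : Fin n × Fin 3) :
    IsWeightedHomogeneous (wt e) (cycBlock (xBlock (F := F) e) a b) 1 := by
  simp only [cycBlock, Matrix.of_apply, xBlock]
  split_ifs
  · have h := isWeightedHomogeneous_X F (wt e) (kappa e (a.1, a.2, b.2))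
    rwa [wt, if_neg (kappa_ne_padPos e _)] at h
  · exact isWeightedHomogeneous_zero F _ _

/-- `trace(C^k)` is weighted-homogeneous of weight `k`. [folklore] -/
private theorem isWeightedHomogeneous_trace_cycBlock_pow (k : ℕ) :
    IsWeightedHomogeneous (wt e) (((cycBlock (xBlock (F := F) e)) ^ k).trace) k :=
  IsWeightedHomogeneous.sum _ _ _ fun a _ =>
    isWeightedHomogeneous_pow_apply (wt e) (isWeightedHomogeneous_cycBlock e) k a a

/-- The `k`-th term `C(N,k) ℓ^{N-k} trace(C^k)` is weighted-homogeneous of weight `k`. [folklore] -/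
private theorem isWeightedHomogeneous_term (M k : ℕ) :
    IsWeightedHomogeneous (wt e)
      (M.choose k • ((X (padPos e) : MvPolynomial (Fin N × Fin N) F) ^ (M - k) *
        ((cycBlock (xBlock (F := F) e)) ^ k).trace)) k := by
  have hℓ : IsWeightedHomogeneous (wt e) ((X (padPos e) : MvPolynomial (Fin N × Fin N) F) ^ (M - k))
      0 := by
    have h := (isWeightedHomogeneous_X F (wt e) (padPos e)).pow (M - k)
    rwa [wt, if_pos rfl, smul_zero] at h
  have hprod := hℓ.mul (isWeightedHomogeneous_trace_cycBlock_pow e k)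
  rw [zero_add] at hprod
  rw [nsmul_eq_mul, ← map_natCast (C : F →+* MvPolynomial (Fin N × Fin N) F)]
  exact hprod.C_mul _

/-- The substituted form `trace(G^N)`, `N = 6n+1`, as a graded sum `∑_{k ≤ N} U_k` with `U_k`
weighted-homogeneous of weight `k` and `U_k = 0` for `k < n`. [folklore] -/
private theorem linSubst_gadgetSubst_tracePow_eq_sum (hN : N = 6 * n + 1) :
    linSubst (Fin N × Fin N) F (gadgetSubst (F := F) e) (tracePow F N N) =
      ∑ k ∈ Finset.range (N + 1),
        if k < n then 0 else
          N.choose k • ((X (padPos e) : MvPolynomial (Fin N × Fin N) F) ^ (N - k) *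
            ((cycBlock (xBlock (F := F) e)) ^ k).trace) := by
  have hodd : Odd N := ⟨3 * n, by omega⟩
  rw [linSubst_gadgetSubst_tracePow, trace_gadget_pow e hodd]
  refine Finset.sum_congr rfl fun k _ => ?_
  by_cases hk0 : k = 0
  · subst hk0
    simp [Nat.pos_of_ne_zero (NeZero.ne n)]
  · rw [if_neg hk0]
    by_cases hkn : k < n
    · rw [if_pos hkn, trace_cycBlock_pow_of_not_dvd _ (fun h => ?_), mul_zero, smul_zero]
      exact absurd (Nat.le_of_dvd (Nat.pos_of_ne_zero hk0) h) (not_le.mpr hkn)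
    · rw [if_neg hkn]

/-- No monomial of `trace(G^N)` has `X`-weight below `n`. [folklore] -/
private theorem le_weight_of_mem_support (hN : N = 6 * n + 1) {d : (Fin N × Fin N) →₀ ℕ}
    (hd : d ∈ (linSubst (Fin N × Fin N) F (gadgetSubst (F := F) e) (tracePow F N N)).support) :
    n ≤ Finsupp.weight (wt e) d := by
  by_contra hlt
  rw [not_le] at hlt
  rw [mem_support_iff, linSubst_gadgetSubst_tracePow_eq_sum e hN, coeff_sum] at hd
  apply hd
  refine Finset.sum_eq_zero fun k _ => ?_
  split_ifs with hk
  · exact coeff_zero _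
  · exact (isWeightedHomogeneous_term e N k).coeff_eq_zero d (by omega)

/-- **The weight-`n` component of `trace(G^N)` is `n C(N,n) · ℓ^{N-n} · IMM_{3,n}(X_κ)`.**
[folklore] -/
private theorem weightedHomogeneousComponent_linSubst_gadgetSubst_tracePow (hN : N = 6 * n + 1) :
    weightedHomogeneousComponent (wt e) n
        (linSubst (Fin N × Fin N) F (gadgetSubst (F := F) e) (tracePow F N N)) =
      ((n * N.choose n : ℕ) : F) •
        ((X (padPos e) : MvPolynomial (Fin N × Fin N) F) ^ (N - n) *
          rename (kappa e) (immPoly 3 n F)) := by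
  classical
  rw [linSubst_gadgetSubst_tracePow_eq_sum e hN, map_sum]
  rw [Finset.sum_eq_single n]
  · rw [if_neg (lt_irrefl n),
      (isWeightedHomogeneous_term e N n).weightedHomogeneousComponent_same,
      trace_cycBlock_pow_self]
    -- `cycProd (xBlock e) 0 n = (immMatrix (Fin 3) n F).map (rename κ)`
    have himm : cycProd (xBlock (F := F) e) 0 n =
        (immMatrix (Fin 3) n F).map (rename (kappa e)) := by
      have hfun : (fun t : Fin n => xBlock (F := F) e (0 + (t : ℕ) • (1 : Fin n))) =
          fun t : Fin n => ((Matrix.mvPolynomialX (Fin 3) (Fin 3) F).map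
            (rename fun ij : Fin 3 × Fin 3 => (t, ij))).map (rename (kappa e)) := by
        funext t
        have ht : (0 : Fin n) + (t : ℕ) • (1 : Fin n) = t := by
          open Fin.NatCast in rw [zero_add, nsmul_one, Fin.cast_val_eq_self]
        rw [ht]
        ext p q
        simp only [Matrix.map_apply, Matrix.mvPolynomialX_apply, rename_X, xBlock, Matrix.of_apply]
      rw [cycProd, hfun, immMatrix, ← (rename (kappa e)).mapMatrix_apply, map_list_prod,
        List.map_map, ← List.ofFn_eq_map]
      rfl
    have htr : (cycProd (xBlock (F := F) e) 0 n).trace = rename (kappa e) (immPoly 3 n F) := by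
      rw [himm, immPoly, ← (rename (kappa e)).mapMatrix_apply]
      simp [Matrix.trace, Matrix.diag, map_sum]
    rw [htr, Nat.cast_mul, mul_smul, Nat.cast_smul_eq_nsmul, Nat.cast_smul_eq_nsmul, smul_comm,
      mul_smul_comm]
  · intro k _ hkn
    by_cases hk : k < n
    · rw [if_pos hk, map_zero]
    · rw [if_neg hk]
      exact (isWeightedHomogeneous_term e N k).weightedHomogeneousComponent_ne n (Ne.symm hkn)
  · intro h
    exfalso
    apply h
    rw [Finset.mem_range]
    omega

end Weights

end MS2001TracePowFormulas

/-! ## §5. The padded `IMM_{3,n}` lies in `Δ[trace(Y^N)]`, `N = 6n+1` -/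

section Main

open MS2001TracePowFormulas

variable {F : Type u} [Field F]

/-- **The heart (one placement)**: for the gadget's placement `κ` and padding entry `ω`,
`ℓ^{N-n} · IMM_{3,n}(X_κ) ∈ Δ[trace(Y^N)]`, `N = 6n + 1`, over every infinite field in which
`n · C(N, n) ≠ 0`. [cite: MulmuleySohoniSIAM2001, §4.1 Remark (AV p.16, all.txt L1122–1124)] -/
theorem X_pow_mul_rename_immPoly_mem_orbitClosure_tracePow_gadget [Infinite F] {n N : ℕ}
    [NeZero n] (hN : N = 6 * n + 1) (e : Vtx n ≃ Fin N)
    (hc : ((n * N.choose n : ℕ) : F) ≠ 0) :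
    (X (padPos e) : MvPolynomial (Fin N × Fin N) F) ^ (N - n) * rename (kappa e) (immPoly 3 n F) ∈
      orbitClosure (tracePow F N N) := by
  classical
  have hNpos : 0 < N := by omega
  set Q := linSubst (Fin N × Fin N) F (gadgetSubst (F := F) e) (tracePow F N N) with hQ
  have hQmem : Q ∈ orbitClosure (tracePow F N N) :=
    endOrbit_subset_orbitClosure_holds _ ⟨gadgetSubst (F := F) e, rfl⟩
  have hQhom : Q.IsHomogeneous N := linSubst_isHomogeneous _ (isHomogeneous_tracePow F N N)
  have hcomp := weightedHomogeneousComponent_mem_orbitClosure hQhom hNpos (wt e)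
    (W₀ := n) (fun d hd => le_weight_of_mem_support e hN hd)
  rw [hQ, weightedHomogeneousComponent_linSubst_gadgetSubst_tracePow e hN] at hcomp
  have hmem := orbitClosure_subset_of_mem_holds hQmem hcomp
  have := smul_mem_orbitClosure (isHomogeneous_tracePow F N N) hNpos hmem
    (((n * N.choose n : ℕ) : F))⁻¹
  rwa [smul_smul, inv_mul_cancel₀ hc, one_smul] at this

/-- **Transfer along projections**: if `y₀^{D-n} · g(X_κ) ∈ Δ[G]` for a form `g` of degree
`n ≤ D`, an injective placement `κ` missing `y₀`, and any `G`, then for every form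
`f` of degree `d ≤ D` that is a PROJECTION of `g`, every placement `ι` and every entry `y`,
`y^{D-d} · f(X_ι) ∈ Δ[G]`: `f` is a projection of `y₀^{D-n} g(X_κ)` (send `y₀ ↦ 1`), so the tree's
padding lemma `X_pow_mul_rename_mem_endOrbit_of_isProjection` and the transitivity of orbit
closures apply. [cite: MulmuleySohoniSIAM2001, Prop. 4.1 (proof, AV p.13, "eq. (3)")] -/
theorem X_pow_mul_rename_mem_orbitClosure_of_isProjection_of_mem [Infinite F] {ρ : Type*}
    [Fintype ρ] [DecidableEq ρ] {υ : Type*} [Fintype υ] {τ : Type*} [Fintype τ]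
    {G : MvPolynomial ρ F} {D : ℕ}
    {g : MvPolynomial υ F} {n : ℕ} (hg : g.IsHomogeneous n) (hnD : n ≤ D)
    {κ : υ → ρ} (hκ : Function.Injective κ) {y₀ : ρ} (hy₀ : ∀ t, κ t ≠ y₀)
    (hmem : X y₀ ^ (D - n) * rename κ g ∈ orbitClosure G)
    {f : MvPolynomial τ F} {d : ℕ} (hf : f.IsHomogeneous d) (hdD : d ≤ D)
    (hfg : IsProjection f g) (ι : τ → ρ) (y : ρ) :
    X y ^ (D - d) * rename ι f ∈ orbitClosure G := by
  classical
  set g' : MvPolynomial ρ F := X y₀ ^ (D - n) * rename κ g with hg'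
  have hg'hom : g'.IsHomogeneous D := by
    have := ((isHomogeneous_X F y₀).pow (D - n)).mul (hg.rename_isHomogeneous (f := κ))
    rwa [one_mul, Nat.sub_add_cancel hnD] at this
  -- `f` is a projection of `g'`
  have hfg' : IsProjection f g' := by
    obtain ⟨a, ha, rfl⟩ := hfg
    let a' : ρ → MvPolynomial τ F := fun p =>
      if h : ∃ t, κ t = p then a h.choose else 1
    have ha'κ : ∀ t, a' (κ t) = a t := by
      intro t
      have h : ∃ t', κ t' = κ t := ⟨t, rfl⟩
      simp only [a', dif_pos h]
      congr 1
      exact hκ h.choose_spec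
    have ha'y : a' y₀ = 1 := by
      simp only [a']
      rw [dif_neg]
      rintro ⟨t, ht⟩
      exact hy₀ t ht
    refine ⟨a', fun p => ?_, ?_⟩
    · by_cases h : ∃ t, κ t = p
      · obtain ⟨t, rfl⟩ := h
        rw [ha'κ]
        exact ha t
      · right
        refine ⟨1, ?_⟩
        simp only [a', dif_neg h, C_1]
    · rw [hg', map_mul, map_pow, aeval_X, ha'y, one_pow, one_mul, aeval_rename,
        show a' ∘ κ = a from funext ha'κ]
  have hend := X_pow_mul_rename_mem_endOrbit_of_isProjection hg'hom hf hdD hfg' ι y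
  exact orbitClosure_subset_of_mem_holds hmem (endOrbit_subset_orbitClosure_holds _ hend)

/-- **Every projection of `IMM_{3,n}` is a padded point of `Δ[trace(Y^N)]`, `N = 6n+1`**: for a
form `f` of degree `d ≤ N` with `IsProjection f (immPoly 3 n F)`, `n ≥ 1`, every placement `ι`
of its variables among the entries of `Y` and every entry `y`, `y^{N-d} · f(X_ι) ∈ Δ[tracePow F N N]`
— over every infinite field with `n · C(N,n) ≠ 0` (e.g. characteristic `0`).
[cite: MulmuleySohoniSIAM2001, §4.1 Remark (AV p.16, all.txt L1122–1124)] -/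
theorem X_pow_mul_rename_mem_orbitClosure_tracePow_of_isProjection [Infinite F] {τ : Type*}
    [Fintype τ] {n N : ℕ} (hn : 1 ≤ n) (hN : N = 6 * n + 1)
    (hc : ((n * N.choose n : ℕ) : F) ≠ 0)
    {f : MvPolynomial τ F} {d : ℕ} (hf : f.IsHomogeneous d) (hd : d ≤ N)
    (hfg : IsProjection f (immPoly 3 n F)) (ι : τ → Fin N × Fin N) (y : Fin N × Fin N) :
    X y ^ (N - d) * rename ι f ∈ orbitClosure (tracePow F N N) := by
  classical
  haveI : NeZero n := ⟨by omega⟩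
  let e : Vtx n ≃ Fin N := Fintype.equivFinOfCardEq ((card_vtx n).trans hN.symm)
  have hheart := X_pow_mul_rename_immPoly_mem_orbitClosure_tracePow_gadget (F := F) hN e hc
  exact X_pow_mul_rename_mem_orbitClosure_of_isProjection_of_mem
    (G := tracePow F N N) (immPoly_isHomogeneous_holds (k := F) 3 n) (by omega)
    (kappa_injective e) (fun t => kappa_ne_padPos e t) hheart hf hd hfg ι y

/-- **`ℓ^{N-n} · IMM_{3,n}` itself lies in `Δ[trace(Y^N)]`, `N = 6n + 1`**, for EVERY placement
`ι` of the `9n` variables of `IMM_{3,n}` among the entries of `Y` and every entry `y`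
(characteristic `0`, `n ≥ 1`). [cite: MulmuleySohoniSIAM2001, §4.1 Remark (AV p.16, all.txt L1122–1124)] -/
theorem X_pow_mul_rename_immPoly_mem_orbitClosure_tracePow [CharZero F] {n N : ℕ} (hn : 1 ≤ n)
    (hN : N = 6 * n + 1) (ι : Fin n × Fin 3 × Fin 3 → Fin N × Fin N) (y : Fin N × Fin N) :
    X y ^ (N - n) * rename ι (immPoly 3 n F) ∈ orbitClosure (tracePow F N N) := by
  have hc : ((n * N.choose n : ℕ) : F) ≠ 0 := by
    rw [Nat.cast_ne_zero]
    exact Nat.mul_ne_zero (by omega) (Nat.choose_pos (by omega)).ne'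
  exact X_pow_mul_rename_mem_orbitClosure_tracePow_of_isProjection hn hN hc
    (immPoly_isHomogeneous_holds (k := F) 3 n) (by omega) ⟨X, fun i => Or.inl ⟨i, rfl⟩,
      by rw [aeval_X_left, AlgHom.id_apply]⟩ ι y

/-- **GCT I §4.1 Remark, the Prop. 4.1 analogue for `trace(Y^N)` HOLDS in characteristic `0`.**
Let `F` be a field of characteristic `0` and `f` a form of degree `d` with a formula of size
`≤ s` (expression size, the tree's `formulaComplexity`). Then for every `n ≥ 6(s+1)^16 + 1`,
`N = 6n + 1 ≥ d`, every placement `ι` of the variables of `f` among the entries of the `N × N`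
variable matrix `Y` and every entry `y`, the padded form `f^φ(Y) = y^{N-d} f(X_ι)` lies in the orbit
closure `Δ[trace(Y^N)]` (compare `MS2001_prop_4_1`: `f^φ ∈ Δ[det_m(Y)]` for every `m ≥ 2·size + 2`).
The print asserts this ("the analogue of Proposition 4.1 holds for `trace(Y^m)`") without proof
and without a characteristic hypothesis; it FAILS whenever `char F ∣ N`
(`MS2001_rem_4_1_trace_prop_4_1_analogue_false_charP`). Proof: Brent + Ben-Or–Cleve (`f` is a
projection of `IMM_{3,n}`: `exists_formula_four_pow_depth_le`, `BenOrCleve.isProjection_immPoly_three`)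
and `X_pow_mul_rename_mem_orbitClosure_tracePow_of_isProjection` (the block-cyclic gadget of this
file). CONSTANT: `N ≥ 36(s+1)^16 + 7` through the tree's Brent constant `4^{depth} ≤ (s+1)^16`;
TODO(sharper form): `N = O(s²)`.
[cite: MulmuleySohoniSIAM2001, §4.1 Remark (AV p.16, all.txt L1122–1124)]
[cite: BenOrCleve1992, Thm. 1] -/
theorem MS2001_rem_4_1_trace_prop_4_1_analogue_charZero [CharZero F] {τ : Type v} [Fintype τ]
    [DecidableEq τ] (f : MvPolynomial τ F) {d s n N : ℕ} (hf : f.IsHomogeneous d)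
    (hs : formulaComplexity f ≤ s) (hn : 6 * (s + 1) ^ 16 + 1 ≤ n) (hN : N = 6 * n + 1)
    (hd : d ≤ N) (ι : τ → Fin N × Fin N) (y : Fin N × Fin N) :
    X y ^ (N - d) * rename ι f ∈ orbitClosure (tracePow F N N) := by
  have hn1 : 1 ≤ n := le_trans (Nat.le_add_left 1 _) hn
  have hc : ((n * N.choose n : ℕ) : F) ≠ 0 := by
    rw [Nat.cast_ne_zero]
    exact Nat.mul_ne_zero (by omega) (Nat.choose_pos (by omega)).ne'
  -- Brent + Ben-Or–Cleve: `f` is a projection of `IMM_{3,n}`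
  obtain ⟨P, -, -, h2, hPf, hPd⟩ := exists_formula_four_pow_depth_le f
  obtain ⟨m, rfl⟩ : ∃ m, n = m + 1 := Nat.exists_eq_add_one_of_ne_zero (by omega)
  have hM : 6 * 4 ^ P.depth ≤ m := by
    have h1 : 4 ^ P.depth ≤ (s + 1) ^ 16 :=
      hPd.trans (Nat.pow_le_pow_left (Nat.succ_le_succ hs) 16)
    omega
  have hproj : IsProjection f (immPoly 3 (m + 1) F) := by
    rw [← hPf]
    exact BenOrCleve.isProjection_immPoly_three P h2 hM
  exact X_pow_mul_rename_mem_orbitClosure_tracePow_of_isProjection hn1 hN hc hf hd hproj ι y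

/-- **The determinant in the trace framework (v2)**: over `ℂ`, for every `m`, with the
quasi-polynomial formula size `s = 2^{18 (7 log₂(m+1) + 11)²}` of `det_m` (tree:
`formulaComplexity_le_of_hasDetRepr`, from BCS (21.33)), every `n ≥ 6(s+1)^16 + 1` and `N = 6n + 1`,
every placement `ι` and entry `y`: `y^{N-m} · det_m(X_ι) ∈ Δ[trace(Y^N)]` — the point `det_m^φ` of
the determinantal framework lies in the class variety of `trace(Y^N)` with quasi-polynomial padding,
so that (by transitivity of orbit closures) `f^φ ∉ Δ[trace(Y^N)]`-type lower bounds imply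
`f^φ ∉ Δ[det_m]`-type lower bounds: "the role of the determinant […] can also be played by the
trace". [cite: MulmuleySohoniSIAM2001, §4.1 Remark (AV p.16, all.txt L1122–1124)] -/
theorem X_pow_mul_rename_detPoly_mem_orbitClosure_tracePow_complex {m n N : ℕ}
    (hn : 6 * (2 ^ (18 * (7 * Nat.log 2 (m + 1) + 11) ^ 2) + 1) ^ 16 + 1 ≤ n) (hN : N = 6 * n + 1)
    (ι : Fin m × Fin m → Fin N × Fin N) (y : Fin N × Fin N) :
    (X y : MvPolynomial (Fin N × Fin N) ℂ) ^ (N - m) * rename ι (detPoly (Fin m) ℂ) ∈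
      orbitClosure (tracePow ℂ N N) := by
  set s : ℕ := 2 ^ (18 * (7 * Nat.log 2 (m + 1) + 11) ^ 2) with hs_def
  have hs : formulaComplexity (detPoly (Fin m) ℂ) ≤ s :=
    formulaComplexity_le_of_hasDetRepr (hasDetRepr_detPoly m) (by simp [Fintype.card_prod]; nlinarith)
  -- `m < s ≤ n ≤ N`
  have hms : m < s := by
    have h1 := Nat.lt_pow_succ_log_self Nat.one_lt_two (m + 1)
    have h2 : Nat.log 2 (m + 1) + 1 ≤ 18 * (7 * Nat.log 2 (m + 1) + 11) ^ 2 := by nlinarith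
    have h3 := Nat.pow_le_pow_right Nat.two_pos h2
    rw [← hs_def] at h3
    have : (Nat.log 2 (m + 1)).succ = Nat.log 2 (m + 1) + 1 := rfl
    omega
  have hd : m ≤ N := by
    have := Nat.le_self_pow (by norm_num : 16 ≠ 0) (s + 1)
    omega
  exact MS2001_rem_4_1_trace_prop_4_1_analogue_charZero (detPoly (Fin m) ℂ)
    (by simpa using detPoly_isHomogeneous (n := Fin m) (k := ℂ)) hs hn hN hd ι y

end Main

end Literature.Computability.AlgebraicComplexity
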